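import Literature.MathematicalPhysics.QuantumFieldTheory.Balaban1983to89.Node00.N24NodesStage13RebindXWithB8PinB10YZW0SepCoPHG

/-!
# NODE N24 · THE N12∕N13-FREE HALF OF THE GENERIC FOUR-PIN ENGINE: the ELEVEN nodes N01–N11 + the 𝐑-OPERATION LEAF, and [16] THEOREM 1's CLAUSE `B16.Thm1Printed w.C`, at a world
# bound to `(upOfRecord₅C (((((θ.rebindX X′).toStage5₁₃CoPH).pinB10).pinY (Y9OfRecord …)).pinZ (Z11OfRecord ζ)).pinW W₀) P).withB8 (b8sel P)` — WITHOUT N12's [IV] leaf and N13's (2.50) exponent row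

TRACK A (YM-PLAN §2d, node N24 of 28 = binder B2), seat `pub-ymgap-dag-n24-c` (R134 fan-out seat, strategy s2; gen 11, Part 36).  A NEW importing module on this seat's fully generic
engine A2 (`N24NodesStage13RebindXWithB8PinB10YZW0SepCoPHG`, p616199).  THEOREMS ONLY, def-free, sorry-free, standard axioms.
WHY (route rev 28∕29, director-ym №210 «(δ) NULL-SET SURGERY, def-level first, route second»; DEF-1 `Node00/Record13SepCoPHV` p620607; plan g85 D85-REV28).  The deciding crux is now
K1⁹ `StabilityBRunRowsAtRecordR13SepCoPHV` (stmt-QuantumFields-27364): the (B) conjunct is read at a RE-CHOSEN datum `datumOfRecord₁₃SepCoPHV F 2 θ h v` (densities re-chosen within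
their `dV`-a.e. classes above level 0).  Its honest supplier road for `∃ v, B16.EndStatementBPrinted (datumⱽ v).C` is dag-n13-w1's junction `K1R9VersionSlotOfAEAtRecord.
exists_revision₁₃_endStatementBPrinted_of_ae` (p62xxxx), whose inputs are [16] THEOREM 1's CLAUSE `B16.Thm1Printed (datumOfRecord₁₃SepCoPH F 2 θ h).C` AT THE UNREVISED RECORD plus
[III] Cor. 3 (2.50) POINTWISE at level 0 and `dV_k`-A.E. at levels `≥ 1`.  Engine A2 delivers (B) = Thm 1 ∧ Cor 3 ONLY JOINTLY (`DagBinding.Nodes` → `Dag.uv_stability_of_series`), reading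
N13's (2.50) row POINTWISE at every level — the currency the slot exists to retire.  THIS MODULE splits the engine along `Dag.uv_stability_of_series`' own proof: Theorem 1's clause
(`densitiesDescribed` under small couplings) needs nodes `B4_main … B14_main` (N01–N11 — NOT `B15_main`, N12's [IV] basic step, which `Dag.uv_stability_of_series` feeds to `B16_main`
only), the located step `FlowStepPrinted` and the 𝐑-OPERATION LEAF `rOperation` — the FIRST conjunct of
`Dag.B16_main`'s conclusion, which at the record is def-T's 𝐑-reading (`hR : ∀ P k < K, TLaw₁₃CoPH θ P k → SLaw₁₃CoPH θ P (k+1)` through A2's `N24_rOperation_iff_…`) — and NOT N13's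
second conjunct (the (2.50) exponents).  §0 `thm1Printed_of_nodes11_of_rOperation` (any `DagBinding.WorldP`: N01–N11 + `rOperation` + `FlowStepPrinted` at every run ⇒
`B16.Thm1Printed w.C` with window `w.γ`; the lines `c4 … dd` of `Dag.uv_stability_of_series` verbatim, `e16.1 ↦ hrop`).  §1 `N24_nodes11_rOperation₁₃CoPH_rebindX_withB8_pinB10YZW₀_pointed`
(A2 §1's hypotheses WITHOUT `h12W` and `hUV` ⇒ the eleven nodes N01–N11 ∧ `(leavesP w P).rOperation` at every run — the [IV] carrier family `W₀` stays a FREE, UNREAD pin of the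
world; A2 §1's proof bytes minus its last two nodes).  KERNEL FACT displayed by the split: on the (δⱽ) road N12's [IV] leaf is NOT in Theorem 1's cone at the record — it is an
in-edge of N13 (`Dag.B16_main` reads `rBasicStep`), i.e. an input of the (2.50) SUPPLIER whose conclusion the slot's K1⁹ closer displays (Summits-side Part 37).  The K1⁹ closers with the slot's teeth
(N13 displayed in the a.e. currency) are the Summits-side Part 37.
HONEST FRAMING: bookkeeping BY NAME over `Dag` ∕ `DagBinding` ∕ engine A2; NO estimate; nothing of Bałaban's asserted; Theorem 1's clause is NOT proved here (it is CONDITIONAL on the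
eleven node sockets, the 𝐑-reading and the flow step, all displayed); N12 ∕ N13 untouched; N24 COMPOSITE — no discharge, no count moved (5∕27 · A 5∕28); one finite 𝕋⁴ programme at fixed ε;
R4 = the conditional finite-𝕋⁴ rung `BalabanLadder.UV` only — NOT continuum ∕ ℝ⁴ ∕ OS ∕ mass gap ∕ Clay.
-/

noncomputable section

open scoped Matrix.Norms.L2Operator

namespace Literature.MathematicalPhysics.QuantumFieldTheory.Balaban1983to89.Node00

open DagBinding T4Continuum T4DatumAssembly FlowStepRuns AveragingRT
open FlowStep (BetaLowerH BetaUpperH)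
open B14NodeKnitRecord9 (b14_main_at_construction_rhoOfRecord9_along)

variable {F : T4Family} {N : ℕ} [NeZero N]

/-! ## §0. [16] Theorem 1's clause from the eleven nodes N01–N11, the 𝐑-operation leaf and the flow step — NO N13, NO exponents (`Dag.uv_stability_of_series`' first half) -/

/-- **THEOREM 1's CLAUSE WITHOUT N13**: at a dependence-function world `w` with `0 < w.γ`, if at every run the nodes `Dag.B4_main … Dag.B14_main` hold at the `leavesP` binding, the
𝐑-operation leaf `(leavesP w P).rOperation` holds and the located flow step `Dag.FlowStepPrinted` holds, then `B16.Thm1Printed w.C` (window `w.γ`).  Proof = the lines `c4 … dd` of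
`Dag.uv_stability_of_series` with `B16_main`'s first conjunct replaced by the leaf itself; `(leavesP w P).densitiesDescribed` IS `∀ k ≤ K, (w.C P).Sect2Form k` under small couplings.
[cite: Balaban1989LargeFieldII, Thm 1 p.355, p.387, p.391; Balaban1988Convergent, Thm 2 p.263 (bookkeeping over the cell's DAG)] -/
theorem thm1Printed_of_nodes11_of_rOperation (w : WorldP) (hγ : 0 < w.γ)
    (h11 : ∀ P : B12.RunParams,
      Dag.B4_main (leavesP w P) ∧ Dag.B5_main (leavesP w P) ∧ Dag.B6_main (leavesP w P) ∧ Dag.B7_main (leavesP w P) ∧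
      Dag.B8_main (leavesP w P) ∧ Dag.B9_main (leavesP w P) ∧ Dag.B10_main (leavesP w P) ∧ Dag.B11_main (leavesP w P) ∧
      Dag.B12_main (leavesP w P) ∧ Dag.B13_main (leavesP w P) ∧ Dag.B14_main (leavesP w P))
    (hrop : ∀ P : B12.RunParams, (leavesP w P).rOperation) (hflow : ∀ P : B12.RunParams, Dag.FlowStepPrinted (leavesP w P)) :
    B16.Thm1Printed w.C := by
  refine ⟨w.γ, hγ, fun P hP k hk => ?_⟩
  obtain ⟨h4, h5, h6, h7, h8, h9, h10, h11', h12, h13, h14⟩ := h11 P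
  have c4 : (leavesP w P).b4 := h4
  have c5 : (leavesP w P).b5 := h5 c4
  have c6 : (leavesP w P).b6 := h6 c4 c5
  have c7 : (leavesP w P).b7 := h7 c5
  have c9 : (leavesP w P).b9 := h9 c4 c5 c6 c7
  have c8 : (leavesP w P).b8 := h8 c5 c6 c7 c9
  have c11 : (leavesP w P).b11 := h11' c5 c6 c7 c8 c9
  have c10 : (leavesP w P).b10 := h10 c5 c6 c7 c8 c9 c11
  have e12 := h12 c4 c5 c6 c7 c8 c9 c10 c11
  have c13 : (leavesP w P).b13 := h13 c9 c10 c11 e12.1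
  have sf : (leavesP w P).smallCouplings → (leavesP w P).smallFieldInductive := e12.2 e12.1 c13
  have dd : (leavesP w P).smallCouplings → (leavesP w P).densitiesDescribed := h14 c7 c8 c9 c10 c11 sf (hflow P) (hrop P)
  exact dd hP k hk

/-! ## §1. The ELEVEN nodes N01–N11 and the 𝐑-operation leaf at the generic four-pin chain (engine A2 §1 without N12's leaf `h12W` and N13's exponent row `hUV`) -/

/-- **★ N24 · THE ELEVEN NODES N01–N11 AND THE 𝐑-OPERATION LEAF AT A WORLD BOUND TO `(upOfRecord₅C (generic four-pin chain over θ.rebindX X′, [IV] family W₀) P).withB8 (b8sel P)`**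
(Core-keyed; `X′`, `W₀`, `b8sel` FREE; `W₀` UNREAD): engine A2 §1's hypotheses WITHOUT N12's leaf `h12W` and N13's (2.50) row `hUV` (N05 ← `h05G`; N06 ∕ N07 ∕ N08 leaves; N09 own
leaf + Theorem-3 member `h09T`; N10 socket; N11 (S1ᵀ) `h11`; the 𝐑-reading `hR`) ⇒ the eleven nodes `Dag.B4_main … Dag.B14_main` and `(leavesP w P).rOperation` (A2 §0's
`N24_rOperation_iff_of_up_withB8_rebindX_pinB10YZW₀_coPH`) at every run.  Proof = A2 §1's bytes minus the `B15_main` ∕ `B16_main` lines. [cite: Balaban1989LargeFieldII, Thm 1 p.355, (0.1) pp.355–356, p.387, p.391; Balaban1985RegularSpaces, Lemma 1 – Thm 8 pp.79–101, Prop. 7 (1.145) p.100, Thm 8 (1.146) p.101; Balaban1985UV3, Thm 1 p.257, Thm 2 p.258; Balaban1985BackgroundPropagators, Thm 3.1 p.397; Balaban1985Variational, Thm 1 p.279, Prop. 7 p.303, Prop. 8 p.304; Balaban1987RG1, Thm 3 p.264, (0.17)–(0.20) pp.255–256, Thm 2 p.259; Balaban1988RG2Cluster, (2.41) p.21; Balaban1988Convergent,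 Thm 2 p.263; Balaban1989LargeFieldI, (0.2)–(0.6) p.176 (bookkeeping)] -/
theorem N24_nodes11_rOperation₁₃CoPH_rebindX_withB8_pinB10YZW₀_pointed (θ : Stage13HParams F N) (hP : θ.Provisos₁₃CoPH F N) (hθ : θ.Admissible F N)
    (X' : B12.RunParams → PrintedCarriersR) (Mstar : ℕ) (ops : OpsY N θ.toStage3Params Mstar) (ζ : ResidZ F N)
    (W₀ : B12.RunParams → PrintedCarriers15) (b8sel : B12.RunParams → Prop) (w : WorldP)
    (hC : w.C = (datumOfRecord₁₃CoPH F N θ hP).C) (hγ : 0 < w.γ ∧ w.γ ≤ θ.γ) (hL : w.L = (θ.L : ℝ))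
    (hup : ∀ P, w.up P = (upOfRecord₅C F N ((((((θ.rebindX F N X').toStage5₁₃CoPH F N).pinB10 F N).pinY F N (Y9OfRecord N θ.toStage3Params Mstar ops)).pinZ F N (Z11OfRecord F N ζ)).pinW F N W₀) P).withB8 (b8sel P))
    (h05G : ∀ P : B12.RunParams, b8sel P)
    (h06 : B9LeafX (Y9OfRecord N θ.toStage3Params Mstar ops))
    (h07 : B11Leaf (Z11OfRecord F N ζ))
    (h08 : PrintedUV3V N θ.L)
    (h09 : ∀ P : B12.RunParams, B12Sec2to5.Lemma4Printed (X' P).F12 (X' P).c12)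
    (h09T : ∀ P : B12.RunParams, (leavesP w P).smallCouplings → (leavesP w P).smallFieldInductive)
    (h10 : ∀ P : B12.RunParams, B9LeafX (Y9OfRecord N θ.toStage3Params Mstar ops) →
      (B10.Thm1PrintedCompact (((((((θ.rebindX F N X').toStage5₁₃CoPH F N).pinB10 F N).pinY F N (Y9OfRecord N θ.toStage3Params Mstar ops)).pinZ F N (Z11OfRecord F N ζ)).pinW F N W₀).res.X P).runs10 ∧
          B10.Thm2Printed (((((((θ.rebindX F N X').toStage5₁₃CoPH F N).pinB10 F N).pinY F N (Y9OfRecord N θ.toStage3Params Mstar ops)).pinZ F N (Z11OfRecord F N ζ)).pinW F N W₀).res.X P).runs10) →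
        B11Leaf (Z11OfRecord F N ζ) → B12Sec2to5.Lemma4Printed (X' P).F12 (X' P).c12 →
          B13.Lemma1Printed (X' P).S13 (X' P).c13 ∧ B13.Lemma2Printed (X' P).S13 (X' P).c13 ∧
            B13.Lemma3Printed (X' P).S13 (X' P).c13)
    (h11 : ∀ P : B12.RunParams, (leavesP w P).b7 → (leavesP w P).b8 → (leavesP w P).b9 → (leavesP w P).b10 → (leavesP w P).b11 →
      (leavesP w P).smallCouplings → (leavesP w P).smallFieldInductive → (leavesP w P).flowControl →
        ∀ k, k < P.K → SLaw₁₃CoPH F N θ P k → TLaw₁₃CoPH F N θ P k)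
    (hR : ∀ (P : B12.RunParams) (k : ℕ), k < P.K → TLaw₁₃CoPH F N θ P k → SLaw₁₃CoPH F N θ P (k + 1)) :
    ∀ P : B12.RunParams, (Dag.B4_main (leavesP w P) ∧ Dag.B5_main (leavesP w P) ∧ Dag.B6_main (leavesP w P) ∧ Dag.B7_main (leavesP w P) ∧
      Dag.B8_main (leavesP w P) ∧ Dag.B9_main (leavesP w P) ∧ Dag.B10_main (leavesP w P) ∧ Dag.B11_main (leavesP w P) ∧
      Dag.B12_main (leavesP w P) ∧ Dag.B13_main (leavesP w P) ∧ Dag.B14_main (leavesP w P)) ∧ (leavesP w P).rOperation := by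
  intro P
  have hrec' := N24_isRecordOfRecord₁₃CCoPH_twin_of_up_withB8_rebindX_pinB10YZW₀ θ hP hθ X' Mstar ops ζ W₀ w hC hγ hL
  have hleaves := leavesP_eq_of_up_withB8 hup P
  have h4 : Dag.B4_main (leavesP w P) := by rw [hleaves]; exact b4_main_of_isRecordOfRecord₁₃CCoPH hrec' P
  have h5 : Dag.B5_main (leavesP w P) := by rw [hleaves]; exact b5_main_of_isRecordOfRecord₁₃CCoPH hrec' P
  have h6 : Dag.B6_main (leavesP w P) := by rw [hleaves]; exact N24_b6_main_of_isRecordOfRecord₁₃CCoPH hrec' P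
  have h7 : Dag.B7_main (leavesP w P) := by rw [hleaves]; exact b7_main_of_isRecordOfRecord₁₃CCoPH hrec' P
  have hw := upOfRecord₅C_pinW_b9_b10_b11 F N (((((θ.rebindX F N X').toStage5₁₃CoPH F N).pinB10 F N).pinY F N (Y9OfRecord N θ.toStage3Params Mstar ops)).pinZ F N (Z11OfRecord F N ζ)) W₀ P
  have hl : ((upOfRecord₅C F N ((((((θ.rebindX F N X').toStage5₁₃CoPH F N).pinB10 F N).pinY F N (Y9OfRecord N θ.toStage3Params Mstar ops)).pinZ F N (Z11OfRecord F N ζ)).pinW F N W₀) P).rBasicStep ↔ B15Leaf (W₀ P)) ∧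
      ((upOfRecord₅C F N ((((((θ.rebindX F N X').toStage5₁₃CoPH F N).pinB10 F N).pinY F N (Y9OfRecord N θ.toStage3Params Mstar ops)).pinZ F N (Z11OfRecord F N ζ)).pinW F N W₀) P).b9 ↔ B9LeafX (Y9OfRecord N θ.toStage3Params Mstar ops)) ∧
      ((upOfRecord₅C F N ((((((θ.rebindX F N X').toStage5₁₃CoPH F N).pinB10 F N).pinY F N (Y9OfRecord N θ.toStage3Params Mstar ops)).pinZ F N (Z11OfRecord F N ζ)).pinW F N W₀) P).b10 ↔ PrintedUV3V N θ.L) ∧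
      ((upOfRecord₅C F N ((((((θ.rebindX F N X').toStage5₁₃CoPH F N).pinB10 F N).pinY F N (Y9OfRecord N θ.toStage3Params Mstar ops)).pinZ F N (Z11OfRecord F N ζ)).pinW F N W₀) P).b11 ↔ B11Leaf (Z11OfRecord F N ζ)) := by
    refine ⟨upOfRecord₅C_pinW_rBasicStep_iff F N _ _ P, ?_, ?_, ?_⟩
    · rw [hw.1, upOfRecord₅C_pinZ_b9]
      exact upOfRecord₅C_pinY_b9_iff F N _ _ P
    · rw [hw.2.1, upOfRecord₅C_pinZ_b10, upOfRecord₅C_pinY_b10]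
      exact upOfRecord₅C_pinB10_b10_iff F N ((θ.rebindX F N X').toStage5₁₃CoPH F N) P
    · rw [hw.2.2]
      exact upOfRecord₅C_pinZ_b11_iff F N _ _ P
  have h8 : (w.up P).b8 := by rw [hup P]; exact h05G P
  have h9 : (w.up P).b9 := by rw [hup P]; exact hl.2.1.2 h06
  have h10leaf : (w.up P).b10 := by rw [hup P]; exact hl.2.2.1.2 h08
  have h11leaf : (w.up P).b11 := by rw [hup P]; exact hl.2.2.2.2 h07
  have h12leaf : (leavesP w P).b12 := by
    show (w.up P).b12
    rw [hup P]; exact h09 P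
  have h13 : Dag.B13_main (leavesP w P) := by
    have h' : Dag.B13_main (leavesP { w with up := fun P => upOfRecord₅C F N ((((((θ.rebindX F N X').toStage5₁₃CoPH F N).pinB10 F N).pinY F N (Y9OfRecord N θ.toStage3Params Mstar ops)).pinZ F N (Z11OfRecord F N ζ)).pinW F N W₀) P } P) :=
      B13NodeKnitRecord5C.b13_main_at_stage5ParamsC F N ((((((θ.rebindX F N X').toStage5₁₃CoPH F N).pinB10 F N).pinY F N (Y9OfRecord N θ.toStage3Params Mstar ops)).pinZ F N (Z11OfRecord F N ζ)).pinW F N W₀) _ P rfl (h10 P)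
    show (w.up P).b9 → (w.up P).b10 → (w.up P).b11 → (w.up P).b12 → (w.up P).b13
    rw [hup P]
    exact h'
  have hrop := N24_rOperation_iff_of_up_withB8_rebindX_pinB10YZW₀_coPH θ X' Mstar ops ζ W₀ (hup P)
  exact ⟨⟨h4, h5, h6, h7, B8LeafKnit.b8_main_of_leaf w P h8, fun _ _ _ _ => h9, fun _ _ _ _ _ _ => h10leaf,
    fun _ _ _ _ _ => h11leaf, B12NodeKnitRecord8.b12_main_of_leaf_of_thm3Member h12leaf (h09T P), h13,
    b14_main_at_construction_rhoOfRecord9_along F N (coreOfRecord₁₃CoPH F N θ) w P θ.ν θ.τ9 (EOfRecord₁₃ F N θ.toStage13Params) (wOfRecord₉ F N θ.toStage9Params) θ.ppSel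
      (gOfRecord₁₃ F N θ.toStage13Params) (fun p k _ => SLaw₁₃CoPH F N θ p k) (fun p k _ => TLaw₁₃CoPH F N θ p k) (hC.trans (datumOfRecord₁₃CoPH_C F N θ hP))
      (fun _ _ => Iff.rfl) (fun _ => sLaw₁₃CoPH_zero F N θ P) (h11 P) (fun hr => hrop.1 hr)⟩, hrop.2 (hR P)⟩


/-! ## §2 (v1.1, append-only). The TWELVE version-blind nodes N01–N12 and the 𝐑-operation leaf (engine A2 §1 without N13's exponent row only) — for worlds re-bound to a REVISED datum -/

/-- **★ N24 · THE TWELVE NODES N01–N12 AND THE 𝐑-OPERATION LEAF AT A WORLD BOUND TO `(upOfRecord₅C (generic four-pin chain over θ.rebindX X′, [IV] family W₀) P).withB8 (b8sel P)`**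
(Core-keyed; `X′`, `W₀`, `b8sel` FREE): engine A2 §1's hypotheses WITHOUT N13's (2.50) row `hUV` — N12's leaf `h12W : ∀ P, B15Leaf (W₀ P)` KEPT (contrast §1) — ⇒ the twelve nodes
`Dag.B4_main … Dag.B15_main` and `(leavesP w P).rOperation` at every run.  The twelve are exactly the VERSION-BLIND nodes of `DagBinding.Nodes` (only `Dag.B16_main` reads `uvBounds`,
dag-n13-w3 p624688 `leavesP_revision₁₃_eq_update` ∕ `nodes_update_uvBounds`): with N13's node supplied AT A WORLD RE-BOUND TO THE REVISED DATUM `datumOfRecord₁₃SepCoPHV θ h v`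
(`b16_main_of_rOperation_of_uvSlot` on the slot letter), they give `Nodes` there — the rung-1ⱽ road of K1⁹'s LINE 2 (plan g86 v9 `stub_nodes13PWSV`).  Proof = A2 §1's bytes minus the
`B16_main` line. [cite: Balaban1989LargeFieldII, Thm 1 p.355, (0.1) pp.355–356, p.387, p.391; Balaban1985RegularSpaces, Lemma 1 – Thm 8 pp.79–101, Prop. 7 (1.145) p.100, Thm 8 (1.146) p.101; Balaban1985UV3, Thm 1 p.257, Thm 2 p.258; Balaban1985BackgroundPropagators, Thm 3.1 p.397; Balaban1985Variational, Thm 1 p.279, Prop. 7 p.303, Prop. 8 p.304; Balaban1987RG1, Thm 3 p.264, (0.17)–(0.20) pp.255–256, Thm 2 p.259; Balaban1988RG2Cluster, (2.41) p.21; Balaban1988Convergent, Thm 2 p.263; Balaban1989LargeFieldI, (0.2)–(0.6) p.176 (bookkeeping)] -/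
theorem N24_nodes12_rOperation₁₃CoPH_rebindX_withB8_pinB10YZW₀_pointed (θ : Stage13HParams F N) (hP : θ.Provisos₁₃CoPH F N) (hθ : θ.Admissible F N)
    (X' : B12.RunParams → PrintedCarriersR) (Mstar : ℕ) (ops : OpsY N θ.toStage3Params Mstar) (ζ : ResidZ F N)
    (W₀ : B12.RunParams → PrintedCarriers15) (b8sel : B12.RunParams → Prop) (w : WorldP)
    (hC : w.C = (datumOfRecord₁₃CoPH F N θ hP).C) (hγ : 0 < w.γ ∧ w.γ ≤ θ.γ) (hL : w.L = (θ.L : ℝ))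
    (hup : ∀ P, w.up P = (upOfRecord₅C F N ((((((θ.rebindX F N X').toStage5₁₃CoPH F N).pinB10 F N).pinY F N (Y9OfRecord N θ.toStage3Params Mstar ops)).pinZ F N (Z11OfRecord F N ζ)).pinW F N W₀) P).withB8 (b8sel P))
    (h05G : ∀ P : B12.RunParams, b8sel P)
    (h06 : B9LeafX (Y9OfRecord N θ.toStage3Params Mstar ops))
    (h07 : B11Leaf (Z11OfRecord F N ζ))
    (h08 : PrintedUV3V N θ.L)
    (h09 : ∀ P : B12.RunParams, B12Sec2to5.Lemma4Printed (X' P).F12 (X' P).c12)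
    (h09T : ∀ P : B12.RunParams, (leavesP w P).smallCouplings → (leavesP w P).smallFieldInductive)
    (h10 : ∀ P : B12.RunParams, B9LeafX (Y9OfRecord N θ.toStage3Params Mstar ops) →
      (B10.Thm1PrintedCompact (((((((θ.rebindX F N X').toStage5₁₃CoPH F N).pinB10 F N).pinY F N (Y9OfRecord N θ.toStage3Params Mstar ops)).pinZ F N (Z11OfRecord F N ζ)).pinW F N W₀).res.X P).runs10 ∧
          B10.Thm2Printed (((((((θ.rebindX F N X').toStage5₁₃CoPH F N).pinB10 F N).pinY F N (Y9OfRecord N θ.toStage3Params Mstar ops)).pinZ F N (Z11OfRecord F N ζ)).pinW F N W₀).res.X P).runs10) →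
        B11Leaf (Z11OfRecord F N ζ) → B12Sec2to5.Lemma4Printed (X' P).F12 (X' P).c12 →
          B13.Lemma1Printed (X' P).S13 (X' P).c13 ∧ B13.Lemma2Printed (X' P).S13 (X' P).c13 ∧
            B13.Lemma3Printed (X' P).S13 (X' P).c13)
    (h11 : ∀ P : B12.RunParams, (leavesP w P).b7 → (leavesP w P).b8 → (leavesP w P).b9 → (leavesP w P).b10 → (leavesP w P).b11 →
      (leavesP w P).smallCouplings → (leavesP w P).smallFieldInductive → (leavesP w P).flowControl →
        ∀ k, k < P.K → SLaw₁₃CoPH F N θ P k → TLaw₁₃CoPH F N θ P k)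
    (h12W : ∀ P : B12.RunParams, B15Leaf (W₀ P))
    (hR : ∀ (P : B12.RunParams) (k : ℕ), k < P.K → TLaw₁₃CoPH F N θ P k → SLaw₁₃CoPH F N θ P (k + 1)) :
    ∀ P : B12.RunParams, (Dag.B4_main (leavesP w P) ∧ Dag.B5_main (leavesP w P) ∧ Dag.B6_main (leavesP w P) ∧ Dag.B7_main (leavesP w P) ∧
      Dag.B8_main (leavesP w P) ∧ Dag.B9_main (leavesP w P) ∧ Dag.B10_main (leavesP w P) ∧ Dag.B11_main (leavesP w P) ∧
      Dag.B12_main (leavesP w P) ∧ Dag.B13_main (leavesP w P) ∧ Dag.B14_main (leavesP w P) ∧ Dag.B15_main (leavesP w P)) ∧ (leavesP w P).rOperation := by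
  intro P
  have hrec' := N24_isRecordOfRecord₁₃CCoPH_twin_of_up_withB8_rebindX_pinB10YZW₀ θ hP hθ X' Mstar ops ζ W₀ w hC hγ hL
  have hleaves := leavesP_eq_of_up_withB8 hup P
  have h4 : Dag.B4_main (leavesP w P) := by rw [hleaves]; exact b4_main_of_isRecordOfRecord₁₃CCoPH hrec' P
  have h5 : Dag.B5_main (leavesP w P) := by rw [hleaves]; exact b5_main_of_isRecordOfRecord₁₃CCoPH hrec' P
  have h6 : Dag.B6_main (leavesP w P) := by rw [hleaves]; exact N24_b6_main_of_isRecordOfRecord₁₃CCoPH hrec' P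
  have h7 : Dag.B7_main (leavesP w P) := by rw [hleaves]; exact b7_main_of_isRecordOfRecord₁₃CCoPH hrec' P
  have hw := upOfRecord₅C_pinW_b9_b10_b11 F N (((((θ.rebindX F N X').toStage5₁₃CoPH F N).pinB10 F N).pinY F N (Y9OfRecord N θ.toStage3Params Mstar ops)).pinZ F N (Z11OfRecord F N ζ)) W₀ P
  have hl : ((upOfRecord₅C F N ((((((θ.rebindX F N X').toStage5₁₃CoPH F N).pinB10 F N).pinY F N (Y9OfRecord N θ.toStage3Params Mstar ops)).pinZ F N (Z11OfRecord F N ζ)).pinW F N W₀) P).rBasicStep ↔ B15Leaf (W₀ P)) ∧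
      ((upOfRecord₅C F N ((((((θ.rebindX F N X').toStage5₁₃CoPH F N).pinB10 F N).pinY F N (Y9OfRecord N θ.toStage3Params Mstar ops)).pinZ F N (Z11OfRecord F N ζ)).pinW F N W₀) P).b9 ↔ B9LeafX (Y9OfRecord N θ.toStage3Params Mstar ops)) ∧
      ((upOfRecord₅C F N ((((((θ.rebindX F N X').toStage5₁₃CoPH F N).pinB10 F N).pinY F N (Y9OfRecord N θ.toStage3Params Mstar ops)).pinZ F N (Z11OfRecord F N ζ)).pinW F N W₀) P).b10 ↔ PrintedUV3V N θ.L) ∧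
      ((upOfRecord₅C F N ((((((θ.rebindX F N X').toStage5₁₃CoPH F N).pinB10 F N).pinY F N (Y9OfRecord N θ.toStage3Params Mstar ops)).pinZ F N (Z11OfRecord F N ζ)).pinW F N W₀) P).b11 ↔ B11Leaf (Z11OfRecord F N ζ)) := by
    refine ⟨upOfRecord₅C_pinW_rBasicStep_iff F N _ _ P, ?_, ?_, ?_⟩
    · rw [hw.1, upOfRecord₅C_pinZ_b9]
      exact upOfRecord₅C_pinY_b9_iff F N _ _ P
    · rw [hw.2.1, upOfRecord₅C_pinZ_b10, upOfRecord₅C_pinY_b10]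
      exact upOfRecord₅C_pinB10_b10_iff F N ((θ.rebindX F N X').toStage5₁₃CoPH F N) P
    · rw [hw.2.2]
      exact upOfRecord₅C_pinZ_b11_iff F N _ _ P
  have h8 : (w.up P).b8 := by rw [hup P]; exact h05G P
  have h9 : (w.up P).b9 := by rw [hup P]; exact hl.2.1.2 h06
  have h10leaf : (w.up P).b10 := by rw [hup P]; exact hl.2.2.1.2 h08
  have h11leaf : (w.up P).b11 := by rw [hup P]; exact hl.2.2.2.2 h07
  have h15 : (w.up P).rBasicStep := by rw [hup P]; exact hl.1.2 (h12W P)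
  have h12leaf : (leavesP w P).b12 := by
    show (w.up P).b12
    rw [hup P]; exact h09 P
  have h13 : Dag.B13_main (leavesP w P) := by
    have h' : Dag.B13_main (leavesP { w with up := fun P => upOfRecord₅C F N ((((((θ.rebindX F N X').toStage5₁₃CoPH F N).pinB10 F N).pinY F N (Y9OfRecord N θ.toStage3Params Mstar ops)).pinZ F N (Z11OfRecord F N ζ)).pinW F N W₀) P } P) :=
      B13NodeKnitRecord5C.b13_main_at_stage5ParamsC F N ((((((θ.rebindX F N X').toStage5₁₃CoPH F N).pinB10 F N).pinY F N (Y9OfRecord N θ.toStage3Params Mstar ops)).pinZ F N (Z11OfRecord F N ζ)).pinW F N W₀) _ P rfl (h10 P)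
    show (w.up P).b9 → (w.up P).b10 → (w.up P).b11 → (w.up P).b12 → (w.up P).b13
    rw [hup P]
    exact h'
  have hrop := N24_rOperation_iff_of_up_withB8_rebindX_pinB10YZW₀_coPH θ X' Mstar ops ζ W₀ (hup P)
  exact ⟨⟨h4, h5, h6, h7, B8LeafKnit.b8_main_of_leaf w P h8, fun _ _ _ _ => h9, fun _ _ _ _ _ _ => h10leaf,
    fun _ _ _ _ _ => h11leaf, B12NodeKnitRecord8.b12_main_of_leaf_of_thm3Member h12leaf (h09T P), h13,
    b14_main_at_construction_rhoOfRecord9_along F N (coreOfRecord₁₃CoPH F N θ) w P θ.ν θ.τ9 (EOfRecord₁₃ F N θ.toStage13Params) (wOfRecord₉ F N θ.toStage9Params) θ.ppSel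
      (gOfRecord₁₃ F N θ.toStage13Params) (fun p k _ => SLaw₁₃CoPH F N θ p k) (fun p k _ => TLaw₁₃CoPH F N θ p k) (hC.trans (datumOfRecord₁₃CoPH_C F N θ hP))
      (fun _ _ => Iff.rfl) (fun _ => sLaw₁₃CoPH_zero F N θ P) (h11 P) (fun hr => hrop.1 hr),
    B15LeafKnit.b15_main_of_up (U := w.up P) rfl h15⟩, hrop.2 (hR P)⟩

end Literature.MathematicalPhysics.QuantumFieldTheory.Balaban1983to89.Node00

end
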